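import Summits.BirchSwinnertonDyer.BirchSwinnertonDyer.Theorems.AdditiveBranchIMCGordTwoRankOneHeegnerKolyvaginSelfTwistUnitsFrame
import Summits.BirchSwinnertonDyer.BirchSwinnertonDyer.Theses.AdditiveBranchIMC
import HarnessLib

/-!
# Route `AdditiveBranchIMC` (rung K1), crux `GordTwoRankOne` (item 19358): the HEIGHT-FREE
# Heegner–Kolyvagin road — Part 22c: the crux BY NAME split along the SELF-TWIST rows, `p = 3` INCLUDED
# (cell `bsd-addord`, second prover lane `bsd-addord-k1-c3x`, gen 5; `--supports 19358 --as helper` only)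

HONEST FRAMING. THEOREMS ONLY: no definition, no new named fact, no `sorry`; nothing is booked; BSD is
not proved by any of this; the crux stays OPEN at class level. This file only SPLITS the route decl
`GordTwoRankOne` (item 19358) along the self-twist rows of Part 22b (p577019,
`cellGordTwo_missingLowerBoundAt_rankOne_of_selfTwistIndexBoundUnits`; Part 21d p576401 was the `p ≥ 5`
split): the rows `p ≡ 3 (mod 4)` (`p = 3` with `K = ℚ(ζ₃)` included),
`ρ̄_{E,p}` onto, every prime `ℓ ≠ p` of `N_E` split in `ℚ(√−p)`, `L(E^{(−p)},1) ≠ 0` — where the LOWER half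
of `BSD(E,p)` follows from PUBLISHED facts (Gross–Zagier, Kolyvagin, GZK, modularity, Wuthrich 2014
Prop. 21, newforms, Mazur 1978 Cor. 4.1, Néron scaling) and ONE typed input, the Jetchev–Skinner–Wan
inequality WITH THE UNIT TERM `2·v_p #𝓞_K^×` for the GOOD ORDINARY `p*`-twist `V` over `ℚ(√−p)` — and the displayed
REST (every other row of the cell: `p ≡ 1 (mod 4)`, non-surjective image, a prime of `N_E/p²` inert or ramified in
`ℚ(√−p)`, or `L(E^{(−p)},1) = 0`), which is lane B's earlier frame (Parts 8 / 17b / 20: STEP L′ at a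
Hoffstein–Luo field in which `p` SPLITS) and lane A's road. The field `K = ℚ(√−p)` itself exists
(`exists_quadraticField_discr_pStar`); it enters as a bound variable of the row hypothesis.

References: [JetchevSkinnerWan2017] §7.4.1; [GrossZagier1986] I.§3, V.§2; [McCallumLMS1991] §1;
[Wuthrich2014] Prop. 21; [Mazur1978] Cor. 4.1; [Miller2011LMS] Def. 1.1.
-/

set_option autoImplicit false
set_option linter.dupNamespace false
noncomputable section

open scoped Classical NumberField
open WeierstrassCurve NumberField IsDedekindDomain
  Literature.NumberTheory.EllipticCurves Literature.NumberTheory.EllipticCurves.ModularForms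
  Literature.NumberTheory.EllipticCurves.Rank1Residual
  Literature.NumberTheory.EllipticCurves.Rank1Residual.Typed
  Summit.BirchSwinnertonDyer.Rank1Residual
  Summit.BirchSwinnertonDyer.Rank1Residual.Additive

namespace Summit.BirchSwinnertonDyer.BirchSwinnertonDyer.Theorems.AdditiveBranchIMCGordTwoRankOne.HeegnerKolyvagin

/-! ### §7 The crux BY NAME along the self-twist rows, unit term kept -/

/-- **Crux `GordTwoRankOne` (item 19358) BY NAME, split along the SELF-TWIST rows at EVERY `p ≡ 3 (mod 4)`.** PUBLISHED binders
(named facts of the tree): `hGZ` (Gross–Zagier / Cai–Shu–Tian), `hKo` (Kolyvagin 1990 Thm. A, qualitative),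
`hGZK`, `hmod` (modularity), `hW21` (Wuthrich 2014 Prop. 21), `hnf` (newforms), `hMaz` (Mazur 1978 Cor. 4.1),
`hNS` (Néron scaling). DISPLAYED inputs: `hL` — the Jetchev–Skinner–Wan inequality
`2·v_p[V(K):ℤP] ≤ v_p #Ш(V/K) + v_p ∏c(V) + v_p ∏c(E) + 2·v_p #𝓞_K^×` for the GOOD ORDINARY `p*`-twist `V` of a
cell row `E` over `K = ℚ(√−p)` at a Manin-good Heegner frame (BSD-consistent with equality; the shape of item 20498
with curve and twist exchanged; in print for NO curve at a prime ramified in `K`); `hRest` — the crux on every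
row of the cell admitting NO self-twist frame (`p ≡ 1 (mod 4)`, `ρ̄_{E,p}` not onto, some `ℓ ∣ N_E/p²` not split in
`ℚ(√−p)`, or `L(E^{(−p)},1) = 0`). An honest split, not a closure; nothing booked; 19358 stays OPEN.
[cite: JetchevSkinnerWan2017, §7.4.1 (eq:shalower), pp. 30–31] [cite: Wuthrich2014, Prop. 21 (p. 400)]
[cite: Mazur1978, Cor. 4.1] [cite: Miller2011LMS, Def. 1.1] -/
theorem gordTwoRankOne_of_selfTwistIndexBoundUnits_of_rest
    (hGZ : ∀ (N : ℕ) [NeZero N] (V : WeierstrassCurve ℚ) (K : Type) [Field K] [NumberField K], gross_zagier N V K)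
    (hKo : ∀ (N : ℕ) [NeZero N] (V : WeierstrassCurve ℚ) (K : Type) [Field K] [NumberField K], kolyvagin N V K)
    (hGZK : rank_eq_analyticRank_of_analyticRank_le_one) (hmod : hasEntireLFunction_rat)
    (hW21 : Wuthrich2014.sha_dvd_analyticSha) (hnf : exists_isNewformOf)
    (hMaz : mazur_not_dvd_maninConstant_of_odd) (hNS : integral_neronScaling_of_isGloballyMinimal)
    (hL : ∀ (V : WeierstrassCurve ℚ) [V.IsElliptic] [V.IsGloballyMinimal] (p : ℕ) [Fact p.Prime]
      [NeZero (V.conductorNorm ℤ)] (K : Type) [Field K] [NumberField K]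
      (W : WeierstrassCurve ℚ) [W.IsElliptic] [W.IsGloballyMinimal] (Cd : VariableChange ℚ)
      (Dt : ModularParametrizationData V (V.conductorNorm ℤ)) (H : HeegnerDatum (V.conductorNorm ℤ) (NumberField.discr K))
      (ι : K →+* ℂ) (P : (V.baseChange K).toAffine.Point),
      V.HasGoodReductionAtPrime p → V.entireLFunction 1 ≠ 0 → V.HasSurjectiveModNGaloisRep p →
      IsImaginaryQuadratic K → NumberField.discr K = -(p : ℤ) → SatisfiesHeegnerHypothesis (V.conductorNorm ℤ) K →
      Cd • V.quadraticTwist (NumberField.discr K : ℚ) = W → W.analyticRank = 1 → N10.CellGordTwo W p →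
      WeierstrassCurve.Affine.Point.map ι.toRatAlgHom P = heegnerPointComplex Dt H → ¬ (p : ℤ) ∣ Dt.c →
      Finite (V.baseChange K).sha →
      (2 * padicValNat p (AddSubgroup.zmultiples P).index : ℤ) ≤
        padicValNat p (V.baseChange K).shaOrder + padicValNat p V.tamagawaProduct + padicValNat p W.tamagawaProduct +
          2 * padicValNat p (Units.torsionOrder K))
    (hRest : ∀ (W : WeierstrassCurve ℚ) [W.IsElliptic] [W.IsGloballyMinimal] (p : ℕ) [Fact p.Prime],
      W.analyticRank = 1 → N10.CellGordTwo W p →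
      (∀ (K : Type) [Field K] [NumberField K], IsImaginaryQuadratic K → NumberField.discr K = -(p : ℤ) →
        p % 4 = 3 → W.HasSurjectiveModNGaloisRep p →
        (∀ ℓ : ℕ, ℓ.Prime → (ℓ : ℤ) ∣ ↑(W.conductorNorm ℤ) → ℓ ≠ p →
          ((Ideal.span {(ℓ : ℤ)}).primesOver (𝓞 K)).ncard = 2) →
        (W.quadraticTwist (-(p : ℚ))).entireLFunction 1 ≠ 0 → False) →
      Typed.MissingLowerBoundAt W p) :
    Summit.BirchSwinnertonDyer.BirchSwinnertonDyer.Theses.AdditiveBranchIMC.GordTwoRankOne := by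
  intro W _ _ p _ hr hc2
  by_cases h : ∃ (K : Type) (_ : Field K) (_ : NumberField K), IsImaginaryQuadratic K ∧
      NumberField.discr K = -(p : ℤ) ∧ p % 4 = 3 ∧ W.HasSurjectiveModNGaloisRep p ∧
      (∀ ℓ : ℕ, ℓ.Prime → (ℓ : ℤ) ∣ ↑(W.conductorNorm ℤ) → ℓ ≠ p →
        ((Ideal.span {(ℓ : ℤ)}).primesOver (𝓞 K)).ncard = 2) ∧
      (W.quadraticTwist (-(p : ℚ))).entireLFunction 1 ≠ 0
  · obtain ⟨K, iF, iN, hK, hdisc, hp4, hsurj, hHeeg, hLt⟩ := h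
    exact cellGordTwo_missingLowerBoundAt_rankOne_of_selfTwistIndexBoundUnits hGZ hKo hGZK hmod hW21 hnf hMaz hNS hL W p
      K hr hc2 hp4 hsurj hK hdisc hHeeg hLt
  · exact hRest W p hr hc2 fun K _ _ hK hdisc hp4 hsurj hHeeg hLt ↦
      h ⟨K, inferInstance, inferInstance, hK, hdisc, hp4, hsurj, hHeeg, hLt⟩

end Summit.BirchSwinnertonDyer.BirchSwinnertonDyer.Theorems.AdditiveBranchIMCGordTwoRankOne.HeegnerKolyvagin

end
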